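import Literature.NumberTheory.ModularSymbols.FullLevelHomologyTwistUp
import Literature.NumberTheory.ModularSymbols.FullLevelHomologyCosetTransferFormula
import HarnessLib

/-!
# `M_θ T_θ^{up}` of a base coset class is `θ(−1)` times the twisted family class `Σ_w [γ] ⊗ θ(w)a δ_{u(w)T̃}`
# (the upstairs, chain-level half of the twist comparison)

Topic `Literature/NumberTheory/ModularSymbols`; namespace `Literature.NumberTheory.ModularSymbols.FullLevel`; sequel of
`FullLevelHomologyTwistUp` (`twistUp`, `twistInvariants`, `M_θ = H1coeffTwist`) and `FullLevelHomologyCosetTransferFormula`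
(`familyChain`).  Definitions with bodies + proved theorems; no named fact, no `sorry`, no instance, no notation.

For `γ ∈ Γ_T` the base coset class is `cosetClass [γ ⊗ aδ_{T̃}] = ⅟|T̃|·[γ ⊗ a·1_{T̃}]`.  Since `R_{u(v)}δ_t = δ_{t u(−v)}`,
`t u(−v) = u(−v t₁/t₂) t` and `θ(det(t u(−v))) = θ(t₁t₂)`, in `k[GL₂(ℤ/p)]`
  `M_θ(Σ_v θ(v) R_{u(v)}(a·1_{T̃})) = θ(−1)·Σ_w θ(w)·a·1_{u(w)T̃}`     (`θ` involutive: `θ(t₁/t₂)θ(t₁t₂) = 1`),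
whence on homology **`twistInvariants_cosetClass_baseCycle`**:
`M_θ T_θ^{up}(cosetClass[γ ⊗ aδ_{T̃}]) = θ(−1)·cosetClass(Σ_w [γ] ⊗ θ(w)a δ_{u(w)T̃})`.
The chain `Σ_w [γ] ⊗ θ(w)aδ_{u(w)T̃}` (`twistFamilyChain`) is a `1`-cycle because `γ̄ ∈ T̃` has determinant `1`
(`twistFamilyChain_mem_cycles₁`).  Also: `unipCoset w = u(w)T̃`, `unipCoset_injective`, `diagElt_smul_unipCoset`.

Consumer: `FullLevelHomologyTwistComparison` (downstairs half), K-line of route BSD/TeichmullerTwistDescent.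

## References
* B. Mazur, J. Tate, J. Teitelbaum, Invent. Math. 84 (1986), §I.8. [MazurTateTeitelbaum1986]
* D. Bump, *Automorphic Forms and Representations* (1997), §4.1 Eq. (1.6)–(1.7). [Bump1997]
* K. S. Brown, *Cohomology of Groups* (1982), Ch. III §5–§6. [Brown1982]
-/

noncomputable section

namespace Literature.NumberTheory.ModularSymbols

namespace FullLevel

open scoped MatrixGroups TensorProduct
open CategoryTheory CongruenceSubgroup groupHomology Finsupp Matrix
open Literature.Algebra.Homology
open Literature.RepresentationTheory.FiniteGroups

variable (k : Type) [CommRing k] (p M : ℕ) [Fact p.Prime]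

/-! ### The cosets `u(w)T̃` -/

/-- The coset `u(w)T̃ ∈ GL₂(ℤ/p)/T̃` of the unipotent `u(w) = (1 w; 0 1)`. [cite: Bump1997, §4.1 Eq. (1.7)] -/
def unipCoset (w : ZMod p) : GL (Fin 2) (ZMod p) ⧸ diagTorus (ZMod p) :=
  ((GL2.upperUnip (ZMod p) w : GL (Fin 2) (ZMod p)) : GL (Fin 2) (ZMod p) ⧸ diagTorus (ZMod p))

/-- `u(v)⁻¹ = u(−v)`. [cite: Bump1997, §4.1 Eq. (1.7)] -/
theorem upperUnip_inv (v : ZMod p) : (GL2.upperUnip (ZMod p) v)⁻¹ = GL2.upperUnip (ZMod p) (-v) := by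
  rw [inv_eq_iff_mul_eq_one, ← GL2.upperUnip_add, add_neg_cancel, GL2.upperUnip_zero]

/-- `w ↦ u(w)T̃` is injective (`u(w' − w) ∈ T̃` forces `w' = w`). [cite: Bump1997, §4.1] -/
theorem unipCoset_injective : Function.Injective (unipCoset p) := by
  intro w w' h
  rw [unipCoset, unipCoset, QuotientGroup.eq, upperUnip_inv, ← GL2.upperUnip_add, mem_diagTorus_iff,
    GL2.coe_upperUnip] at h
  have h' : -w + w' = 0 := by simpa using h.1
  exact neg_add_eq_zero.1 h'

/-- `diag(c₁, c₂) · u(w)T̃ = u(c₁ w / c₂)T̃`. [cite: Bump1997, §4.1 Eq. (1.7)] -/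
theorem diagElt_smul_unipCoset (c₁ c₂ : (ZMod p)ˣ) (w : ZMod p) :
    GL2.diagElt (ZMod p) c₁ c₂ • unipCoset p w = unipCoset p ((c₁ : ZMod p) * w / c₂) := by
  rw [unipCoset, unipCoset, MulAction.Quotient.smul_coe, smul_eq_mul, GL2.diagElt_mul_upperUnip, QuotientGroup.eq,
    _root_.mul_inv_rev, mul_assoc, inv_mul_cancel, mul_one]
  exact inv_mem (diagElt_mem_diagTorus p c₁ c₂)

/-- `u(w) · T̃ = u(w)T̃`. [cite: Bump1997, §4.1] -/
theorem upperUnip_smul_baseCoset (w : ZMod p) : GL2.upperUnip (ZMod p) w • baseCoset p = unipCoset p w := by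
  rw [baseCoset_eq, MulAction.Quotient.smul_coe, smul_eq_mul, mul_one, unipCoset]

/-- For `γ ∈ Γ_T`, `γ̄ ∈ T̃`. [cite: DiamondShurman2005, §1.5] -/
theorem redGL_mem_diagTorus_of_mem_torusLevel {γ : Gamma0 M} (hγ : γ ∈ torusLevel p M) :
    redGL p M γ ∈ diagTorus (ZMod p) := by
  have h := smul_baseCoset_of_mem_torusLevel p M hγ
  rw [baseCoset_eq, MulAction.Quotient.smul_coe, smul_eq_mul, mul_one, QuotientGroup.eq, mul_one] at h
  exact (Subgroup.inv_mem_iff _).1 h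

/-! ### Involutive characters: small identities -/

/-- `θ(−1)² = 1` (as `MulChar.ofUnitHom θ (−1)`) for an involutive `θ`. [cite: Bump1997, §4.1] -/
theorem ofUnitHom_neg_one_mul_self (θ : (ZMod p)ˣ →* kˣ) (hθ : ∀ u, θ u * θ u = 1) :
    MulChar.ofUnitHom θ (-1 : ZMod p) * MulChar.ofUnitHom θ (-1 : ZMod p) = 1 := by
  rw [← Units.coe_neg_one, MulChar.ofUnitHom_coe, ← Units.val_mul, hθ, Units.val_one]

/-- `θ(−x) = θ(−1)θ(x)`. [cite: Bump1997, §4.1] -/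
theorem ofUnitHom_neg (θ : (ZMod p)ˣ →* kˣ) (x : ZMod p) :
    MulChar.ofUnitHom θ (-x) = MulChar.ofUnitHom θ (-1 : ZMod p) * MulChar.ofUnitHom θ x := by
  rw [neg_eq_neg_one_mul, map_mul]

/-- For `γ ∈ Γ_T` and an involutive `θ`: writing `γ̄⁻¹ = diag(c₁,c₂)`, `θ(c₁)θ(c₂) = 1` (`det γ̄ = 1`).
[cite: DiamondShurman2005, §1.2] -/
theorem theta_mul_theta_eq_one_of_diagElt_eq_redGL_inv (θ : (ZMod p)ˣ →* kˣ) {γ : Gamma0 M} {c₁ c₂ : (ZMod p)ˣ}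
    (h : GL2.diagElt (ZMod p) c₁ c₂ = (redGL p M γ)⁻¹) : (θ c₁ : k) * (θ c₂ : k) = 1 := by
  rw [← detChar_diagElt k p θ c₁ c₂, h]
  have h1 := detChar_inv_mul k p θ (redGL p M γ)
  rwa [detChar_redGL, mul_one] at h1

/-! ### The twisted family chain `Σ_w [γ] ⊗ θ(w)a δ_{u(w)T̃}` -/

/-- The twisted family chain `Σ_w [γ] ⊗ θ(w)a·δ_{u(w)T̃}` (coefficients in `k[GL₂(ℤ/p)/T̃]`).
[cite: MazurTateTeitelbaum1986, §I.8] -/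
def twistFamilyChain (θ : (ZMod p)ˣ →* kˣ) (γ : Gamma0 M) (a : k) :
    Gamma0 M →₀ PermutationCoeff.permRepObj k (redGL p M) (GL (Fin 2) (ZMod p) ⧸ diagTorus (ZMod p)) :=
  familyChain k p M (fun _ : ZMod p => γ) (unipCoset p) (fun w => MulChar.ofUnitHom θ w * a)

/-- The coefficient `Σ_w θ(w)a δ_{u(w)T̃} ∈ k[GL₂(ℤ/p)/T̃]`. [cite: MazurTateTeitelbaum1986, §I.8] -/
def twistCosetCoeff (θ : (ZMod p)ˣ →* kˣ) (a : k) :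
    PermutationCoeff.permRepObj k (redGL p M) (GL (Fin 2) (ZMod p) ⧸ diagTorus (ZMod p)) :=
  ∑ w : ZMod p, single (unipCoset p w) (MulChar.ofUnitHom θ w * a)

/-- `twistFamilyChain = [γ] ⊗ Σ_w θ(w)a δ_{u(w)T̃}`. [cite: MazurTateTeitelbaum1986, §I.8] -/
theorem twistFamilyChain_eq (θ : (ZMod p)ˣ →* kˣ) (γ : Gamma0 M) (a : k) :
    twistFamilyChain k p M θ γ a = single γ (twistCosetCoeff k p M θ a) := by
  rw [twistFamilyChain, familyChain, twistCosetCoeff, Finsupp.single_finsetSum]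

/-- **`γ · (Σ_w θ(w)a δ_{u(w)T̃}) = Σ_w θ(w)a δ_{u(w)T̃}` for `γ ∈ Γ_T`** (involutive `θ`): `γ̄⁻¹ = diag(c₁,c₂)` permutes
the cosets `u(w)T̃ ↦ u(c₁w/c₂)T̃` and `θ(c₂/c₁) = θ(c₁)θ(c₂) = θ(det γ̄⁻¹) = 1`. [cite: Bump1997, §4.1 Eq. (1.7)] -/
theorem permRep_inv_twistCosetCoeff (θ : (ZMod p)ˣ →* kˣ) (hθ : ∀ u, θ u * θ u = 1) (γ : torusLevel p M) (a : k) :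
    PermutationCoeff.permRep k (redGL p M) (GL (Fin 2) (ZMod p) ⧸ diagTorus (ZMod p)) γ.1⁻¹ (twistCosetCoeff k p M θ a) =
      twistCosetCoeff k p M θ a := by
  obtain ⟨c₁, c₂, hc⟩ := exists_diagElt_eq p (inv_mem (redGL_mem_diagTorus_of_mem_torusLevel p M γ.2))
  have h1 : (θ c₁ : k) * (θ c₂ : k) = 1 :=
    theta_mul_theta_eq_one_of_diagElt_eq_redGL_inv k p M θ hc
  have hq : (c₁ : ZMod p) / c₂ ≠ 0 := div_ne_zero c₁.ne_zero c₂.ne_zero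
  rw [twistCosetCoeff, map_sum]
  simp_rw [PermutationCoeff.permRep_single, map_inv, ← hc, diagElt_smul_unipCoset]
  refine Fintype.sum_equiv (Equiv.mulRight₀ ((c₁ : ZMod p) / c₂) hq) _ _ fun w => ?_
  simp only [Equiv.mulRight₀_apply]
  have e1 : (c₁ : ZMod p) * w / c₂ = w * ((c₁ : ZMod p) / c₂) := by ring
  have e2 : MulChar.ofUnitHom θ (w * ((c₁ : ZMod p) / c₂)) = MulChar.ofUnitHom θ w := by
    rw [map_mul, ofUnitHom_div_of_mul_self k p θ hθ c₂ c₁, mul_comm (θ c₂ : k), h1, mul_one]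
  rw [e1, e2]

/-- **The twisted family chain is a `1`-cycle** (`γ ∈ Γ_T`, involutive `θ`). [cite: MazurTateTeitelbaum1986, §I.8] -/
theorem twistFamilyChain_mem_cycles₁ (θ : (ZMod p)ˣ →* kˣ) (hθ : ∀ u, θ u * θ u = 1) (γ : torusLevel p M) (a : k) :
    twistFamilyChain k p M θ γ.1 a ∈
      cycles₁ (PermutationCoeff.permRepObj k (redGL p M) (GL (Fin 2) (ZMod p) ⧸ diagTorus (ZMod p))) := by
  rw [twistFamilyChain_eq, single_mem_cycles₁_iff]
  have h := permRep_inv_twistCosetCoeff k p M θ hθ γ a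
  -- `single g f ∈ cycles₁ ↔ ρ g f = f`; from `ρ g⁻¹ f = f` apply `ρ g`
  have h2 := congrArg (PermutationCoeff.permRep k (redGL p M) (GL (Fin 2) (ZMod p) ⧸ diagTorus (ZMod p)) γ.1) h
  rw [← Module.End.mul_apply, ← map_mul, mul_inv_cancel, map_one, Module.End.one_apply] at h2
  exact h2.symm

/-- The twisted family cycle. [cite: MazurTateTeitelbaum1986, §I.8] -/
def twistFamilyCycle (θ : (ZMod p)ˣ →* kˣ) (hθ : ∀ u, θ u * θ u = 1) (γ : torusLevel p M) (a : k) :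
    cycles₁ (PermutationCoeff.permRepObj k (redGL p M) (GL (Fin 2) (ZMod p) ⧸ diagTorus (ZMod p))) :=
  ⟨twistFamilyChain k p M θ γ.1 a, twistFamilyChain_mem_cycles₁ k p M θ hθ γ a⟩

/-- The element of `T̃` attached to a pair of units is `diag(t₁, t₂)`. [cite: Bump1997, §4.1 Eq. (1.6)] -/
theorem coe_diagTorusEquiv (t : (ZMod p)ˣ × (ZMod p)ˣ) :
    ((diagTorusEquiv (ZMod p) t : diagTorus (ZMod p)) : GL (Fin 2) (ZMod p)) = GL2.diagElt (ZMod p) t.1 t.2 := by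
  rw [← diagUnits_eq_diagElt]
  rfl

/-- `T_θ^{up}[c] = [Σ_v θ(v)·R_{u(v)} c]` on classes of `1`-cycles. [cite: MazurTateTeitelbaum1986, §I.8] -/
theorem twistUp_H1π (θ : (ZMod p)ˣ →* kˣ) (c : cycles₁ (coeff k p M)) :
    twistUp k p M θ (H1π _ c) =
      H1π _ (∑ v : ZMod p, MulChar.ofUnitHom θ v •
        mapCycles₁ (MonoidHom.id _) (PermutationCoeff.rightTranslation (redGL p M) (GL2.upperUnip (ZMod p) v)) c) := by
  rw [twistUp_apply, map_sum]
  refine Finset.sum_congr rfl fun v _ => ?_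
  rw [map_smul, H1carrierRep_H1π]

/-! ### The `k[GL₂(ℤ/p)]`-identity behind `M_θ T_θ^{up}` on a base coset indicator -/

variable [Fintype (diagTorus (ZMod p))]

/-- **`M_θ(Σ_v θ(v)·R_{u(v)}(a·1_{T̃})) = θ(−1)·Σ_w θ(w)a·1_{u(w)T̃}` in `k[GL₂(ℤ/p)]`** (involutive `θ`).
[cite: MazurTateTeitelbaum1986, §I.8; Bump1997, §4.1 Eq. (1.7)] -/
theorem coeffTwistLin_sum_rightTranslation_cosetIndicator (θ : (ZMod p)ˣ →* kˣ) (hθ : ∀ u, θ u * θ u = 1) (a : k) :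
    coeffTwistLin k p M θ (∑ v : ZMod p, MulChar.ofUnitHom θ v •
        (PermutationCoeff.rightTranslation (k := k) (redGL p M) (GL2.upperUnip (ZMod p) v)).hom
          (a • PermutationCoeff.cosetIndicator (k := k) (redGL p M) (diagTorus (ZMod p)) (baseCoset p))) =
      MulChar.ofUnitHom θ (-1 : ZMod p) • ∑ w : ZMod p, (MulChar.ofUnitHom θ w * a) •
        PermutationCoeff.cosetIndicator (k := k) (redGL p M) (diagTorus (ZMod p)) (unipCoset p w) := by
  -- both sides as double sums `Σ_{v or w} Σ_{(t₁,t₂)}` of singles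
  have hL : ∀ v : ZMod p, coeffTwistLin k p M θ (MulChar.ofUnitHom θ v •
      (PermutationCoeff.rightTranslation (k := k) (redGL p M) (GL2.upperUnip (ZMod p) v)).hom
        (a • PermutationCoeff.cosetIndicator (k := k) (redGL p M) (diagTorus (ZMod p)) (baseCoset p))) =
      ∑ t : (ZMod p)ˣ × (ZMod p)ˣ, Finsupp.single (GL2.upperUnip (ZMod p) (t.1 * -v / t.2) * GL2.diagElt (ZMod p) t.1 t.2)
        (((θ t.1 : k) * (θ t.2 : k)) * (MulChar.ofUnitHom θ v * a)) := fun v => by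
    rw [baseCoset_eq, PermutationCoeff.cosetIndicator_coe, Finset.smul_sum, map_sum, Finset.smul_sum, map_sum]
    refine Fintype.sum_equiv (diagTorusEquiv (ZMod p)).symm _ _ fun h => ?_
    obtain ⟨t, rfl⟩ := (diagTorusEquiv (ZMod p)).surjective h
    rw [Equiv.symm_apply_apply, coe_diagTorusEquiv, one_mul, Finsupp.smul_single, smul_eq_mul, mul_one,
      PermutationCoeff.rightTranslation_single, upperUnip_inv, GL2.diagElt_mul_upperUnip, Finsupp.smul_single,
      smul_eq_mul, coeffTwistLin_single, detChar_mul, detChar_upperUnip, one_mul, detChar_diagElt]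
  have hR : ∀ w : ZMod p, MulChar.ofUnitHom θ (-1 : ZMod p) • ((MulChar.ofUnitHom θ w * a) •
      PermutationCoeff.cosetIndicator (k := k) (redGL p M) (diagTorus (ZMod p)) (unipCoset p w)) =
      ∑ t : (ZMod p)ˣ × (ZMod p)ˣ, Finsupp.single (GL2.upperUnip (ZMod p) w * GL2.diagElt (ZMod p) t.1 t.2)
        (MulChar.ofUnitHom θ (-1 : ZMod p) * (MulChar.ofUnitHom θ w * a)) := fun w => by
    rw [unipCoset, PermutationCoeff.cosetIndicator_coe, Finset.smul_sum, Finset.smul_sum]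
    refine Fintype.sum_equiv (diagTorusEquiv (ZMod p)).symm _ _ fun h => ?_
    obtain ⟨t, rfl⟩ := (diagTorusEquiv (ZMod p)).surjective h
    rw [Equiv.symm_apply_apply, coe_diagTorusEquiv, Finsupp.smul_single, smul_eq_mul, mul_one, Finsupp.smul_single,
      smul_eq_mul]
  rw [map_sum, Finset.smul_sum, Finset.sum_congr rfl (fun v _ => hL v), Finset.sum_congr rfl (fun w _ => hR w),
    Finset.sum_comm]
  conv_rhs => rw [Finset.sum_comm]
  refine Finset.sum_congr rfl fun t _ => ?_
  have hq : -(t.1 : ZMod p) / t.2 ≠ 0 := div_ne_zero (neg_ne_zero.2 t.1.ne_zero) t.2.ne_zero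
  refine Fintype.sum_equiv (Equiv.mulRight₀ (-(t.1 : ZMod p) / t.2) hq) _ _ fun v => ?_
  have e1 : (t.1 : ZMod p) * -v / t.2 = v * (-(t.1 : ZMod p) / t.2) := by ring
  have e2 : MulChar.ofUnitHom θ (v * (-(t.1 : ZMod p) / t.2)) =
      MulChar.ofUnitHom θ (-1 : ZMod p) * MulChar.ofUnitHom θ v * ((θ t.1 : k) * (θ t.2 : k)) := by
    rw [neg_div, ← neg_mul_eq_mul_neg, ofUnitHom_neg, map_mul, ofUnitHom_div_of_mul_self k p θ hθ t.2 t.1,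
      mul_comm (θ t.2 : k)]
    ring
  have e3 : MulChar.ofUnitHom θ (-1 : ZMod p) * (MulChar.ofUnitHom θ (-1 : ZMod p) * MulChar.ofUnitHom θ v *
      ((θ t.1 : k) * (θ t.2 : k)) * a) = (MulChar.ofUnitHom θ (-1 : ZMod p) * MulChar.ofUnitHom θ (-1 : ZMod p)) *
      (((θ t.1 : k) * (θ t.2 : k)) * (MulChar.ofUnitHom θ v * a)) := by ring
  show Finsupp.single _ _ = Finsupp.single (GL2.upperUnip (ZMod p) (v * (-(t.1 : ZMod p) / t.2)) * _)
    (MulChar.ofUnitHom θ (-1 : ZMod p) * (MulChar.ofUnitHom θ (v * (-(t.1 : ZMod p) / t.2)) * a))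
  rw [e1, e2, e3, ofUnitHom_neg_one_mul_self k p θ hθ, one_mul]

/-! ### On homology: `M_θ T_θ^{up}` of a base coset class -/

/-- The lifted chain of the base coset cycle: `[γ] ⊗ a·1_{T̃}`. [cite: Brown1982, Ch. III §5] -/
theorem liftCosetChain_baseCycle (γ : torusLevel p M) (a : k) :
    liftCosetChain k p M (baseCycle k p M γ a).1 =
      Finsupp.single γ.1 (a • PermutationCoeff.cosetIndicator (k := k) (redGL p M) (diagTorus (ZMod p)) (baseCoset p)) := by
  rw [baseCycle, liftCosetChain, mapRange.linearMap_apply, mapRange_single]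
  exact congrArg (Finsupp.single γ.1) (PermutationCoeff.cosetLiftHom_single (redGL p M) (diagTorus (ZMod p)) (baseCoset p) a)

/-- The lifted chain of the twisted family chain: `[γ] ⊗ Σ_w θ(w)a·1_{u(w)T̃}`. [cite: Brown1982, Ch. III §5] -/
theorem liftCosetChain_twistFamilyChain (θ : (ZMod p)ˣ →* kˣ) (γ : Gamma0 M) (a : k) :
    liftCosetChain k p M (twistFamilyChain k p M θ γ a) =
      Finsupp.single γ (∑ w : ZMod p, (MulChar.ofUnitHom θ w * a) •
        PermutationCoeff.cosetIndicator (k := k) (redGL p M) (diagTorus (ZMod p)) (unipCoset p w)) := by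
  rw [twistFamilyChain_eq, liftCosetChain, mapRange.linearMap_apply, mapRange_single, twistCosetCoeff, map_sum]
  congr 1
  refine Finset.sum_congr rfl fun w _ => ?_
  exact PermutationCoeff.cosetLiftHom_single (redGL p M) (diagTorus (ZMod p)) (unipCoset p w) _

variable [Invertible (Fintype.card (diagTorus (ZMod p)) : k)]

/-- **`M_θ T_θ^{up}` of a base coset class**: for `γ ∈ Γ_T` and an involutive `θ`,
`twistInvariants θ (cosetClass [γ ⊗ aδ_{T̃}]) = θ(−1) · cosetClass (Σ_w [γ] ⊗ θ(w)a δ_{u(w)T̃})`.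
[cite: MazurTateTeitelbaum1986, §I.8; Brown1982, Ch. III §6] -/
theorem twistInvariants_cosetClass_baseCycle (θ : (ZMod p)ˣ →* kˣ) (hθ : ∀ u, θ u * θ u = 1) (γ : torusLevel p M)
    (a : k) : (twistInvariants k p M θ hθ (cosetClass k p M (baseCycle k p M γ a)) : H1carrier k p M) =
      MulChar.ofUnitHom θ (-1 : ZMod p) • (cosetClass k p M (twistFamilyCycle k p M θ hθ γ a) : H1carrier k p M) := by
  rw [coe_twistInvariants, coe_cosetClass, coe_cosetClass, map_smul, map_smul, smul_comm]
  congr 1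
  rw [twistUp_H1π, H1coeffTwist_H1π, ← map_smul]
  congr 1
  have e : ∀ v : ZMod p, ((MulChar.ofUnitHom θ v • mapCycles₁ (MonoidHom.id _)
      (PermutationCoeff.rightTranslation (redGL p M) (GL2.upperUnip (ZMod p) v))
      (⟨liftCosetChain k p M (baseCycle k p M γ a).1, liftCosetChain_mem_cycles₁ k p M (baseCycle k p M γ a)⟩ :
        cycles₁ (coeff k p M)) : cycles₁ (coeff k p M)) : Gamma0 M →₀ coeff k p M) =
      Finsupp.single γ.1 (MulChar.ofUnitHom θ v •
        (PermutationCoeff.rightTranslation (k := k) (redGL p M) (GL2.upperUnip (ZMod p) v)).hom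
          (a • PermutationCoeff.cosetIndicator (k := k) (redGL p M) (diagTorus (ZMod p)) (baseCoset p))) := fun v => by
    rw [Submodule.coe_smul, coe_mapCycles₁_rightTranslation]
    show MulChar.ofUnitHom θ v • mapRange.linearMap _ (liftCosetChain k p M (baseCycle k p M γ a).1) = _
    rw [liftCosetChain_baseCycle, mapRange.linearMap_apply, mapRange_single, Finsupp.smul_single]
    rfl
  apply Subtype.ext
  show _ = MulChar.ofUnitHom θ (-1 : ZMod p) • liftCosetChain k p M (twistFamilyChain k p M θ γ.1 a)
  rw [coe_mapCycles₁_coeffTwist, Submodule.coe_sum, liftCosetChain_twistFamilyChain,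
    Finset.sum_congr rfl (fun v _ => e v), ← Finsupp.single_finsetSum, mapRange.linearMap_apply, mapRange_single,
    coeffTwistLin_sum_rightTranslation_cosetIndicator k p M θ hθ a, Finsupp.smul_single]

/-- The same identity in the invariants `H₁(Γ₀(M), k[GL₂(ℤ/p)])^{T̃}` (as elements of the submodule).
[cite: MazurTateTeitelbaum1986, §I.8] -/
theorem twistInvariants_cosetClass_baseCycle_eq (θ : (ZMod p)ˣ →* kˣ) (hθ : ∀ u, θ u * θ u = 1) (γ : torusLevel p M)
    (a : k) : twistInvariants k p M θ hθ (cosetClass k p M (baseCycle k p M γ a)) =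
      MulChar.ofUnitHom θ (-1 : ZMod p) • cosetClass k p M (twistFamilyCycle k p M θ hθ γ a) :=
  Subtype.ext (by rw [Submodule.coe_smul]; exact twistInvariants_cosetClass_baseCycle k p M θ hθ γ a)

/-- `cosetClass (twistFamilyCycle …)` is the coset class of the family chain with constant element `γ`, cosets `u(w)T̃`
and coefficients `θ(w)a` (definitional unfolding, for use with `torusInvariantsToCuspidal_cosetClass_family`).
[cite: Brown1982, Ch. III §9 (A)] -/
theorem cosetClass_twistFamilyCycle_eq (θ : (ZMod p)ˣ →* kˣ) (hθ : ∀ u, θ u * θ u = 1) (γ : torusLevel p M) (a : k) :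
    cosetClass k p M (twistFamilyCycle k p M θ hθ γ a) =
      cosetClass k p M ⟨familyChain k p M (fun _ : ZMod p => γ.1) (unipCoset p) (fun w => MulChar.ofUnitHom θ w * a),
        twistFamilyChain_mem_cycles₁ k p M θ hθ γ a⟩ := rfl

end FullLevel

end Literature.NumberTheory.ModularSymbols
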